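import Summits.QuantumFields.YangMills.Theorems.BalabanUVNodesN05SubBP2DSlotExistsGuarded
import Summits.QuantumFields.YangMills.Theorems.BalabanUVNodesN05SubBP2DPerKappaSlotOfZd
import Summits.QuantumFields.YangMills.Theorems.BalabanUVNodesN05SubBP2DPerT8SrvGammaPrime
import Literature.MathematicalPhysics.QuantumFieldTheory.Balaban1983to89.B8Prop7GlevZd3

/-!
# BalabanUVNodes ∕ N05 ([Balaban1985RegularSpaces] Lemma 1 p. 79 – Thm 8 p. 101, (1.3)–(1.5) p. 77, p. 77 «Ω_j ⊂ T_η»): P4 — THE GUARDED κ-PERIODIC SLOT INHABITED FROM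
# THE SAME [4]-TYPE LETTERS AS THE «P₂D» ROW (director-ym №217 (ii) ∕ №220 A-4 ∕ №222 A-5′ (ii): «an N05 discharge is bookable ONLY on the guarded κ-periodic slot road»)

Track A of `YM-PLAN.md` (cell `pub-ymgap`, HUMAN RULING D-0062), node **N05**; seat `pub-ymgap-dag-n05-d` (g14, P4 pen), 2026-08-28; bears on K1⁹ `stmt-QuantumFields-27364`
(`--supports … --as helper`, count-neutral).

WHAT.  p638230's guarded root `exists_residB8_b8LeafOfRecordSubBP₂D_cutSubBP₅_of_lettersSrc_γ'_guarded` — hypotheses VERBATIM ([Balaban1985BackgroundPropagators]'s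
primitive constants, [4]'s letters `SLet ∕ SLetUB`, the b9 sockets `SB9P ∕ SH59src ∕ SB9srcHP` at the (1.3)–(1.5)-admissible `Ω₀ = ℤᵈ` law members, Theorem 8's socket-side
constants) — RE-RUN TO THE (β′-PERIODIC) κ-CUT SLOT of dag-n05-w1 (`Node00.B8LeafOfRecordSubBP₂DPerκ θ P M₁ R`, K2 p643053) at EVERY period `P` and EVERY pinned pair `(M₁, R)`:
the layer and the ℤᵈ «P₂D» slot at the P₅-pinned print-class cut exactly as in p638230 (`exists_residB8_layer_guarded` + p618522's knit); Theorem 8's surviving form AT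
THE PERIODIC δ₂-MEMBERS from the SAME letters (this seat's `…N05SubBP2DPerT8SrvGammaPrime.t8P₂DPer_of_lettersSrc_γ'` on CLAIM-7's periodic server, exit E8a); the display's
Proposition-7 slot at the unit-axial map on the periodic carriers («return `(U₀, 1)`»; the (K1)-P census witness `B8Prop7GlevZd3P.prop7PrintedR_zdGF3P_unitAxial_comp` re-run
on `zdGF3HP₂Per` — content only once `toAxial` is print's); then this seat's FILE 1 `…N05SubBP2DPerKappaSlotOfZd.b8LeafOfRecordSubBP₂DPerκ_of_subBP₂D` (transfer′ + K2).

WHAT IS PROVED (three theorems; no estimate; no new definition):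
* `prop7PrintedR_famB8OfRecordSubBP₂DPer_unitAxial` — the typed Proposition 7 at the periodic δ₂-family holds at the unit-axial map (census witness; typed sentence, junk map).
* ★★★ `exists_residB8_b8LeafOfRecordSubBP₂DPerκ_cutSubBP₅_of_lettersSrc_γ'_guarded` — p638230's hypotheses VERBATIM `(P M₁ R : ℕ)` ⊢
  `∃ lam c₁ ρ₀ ax, 0 < c₁ ∧ 1 ≤ ρ₀ ∧ B8LeafOfRecordSubBP₂DPerκ θ P M₁ R ⟨lam.cutSubBP₅ c₁ ρ₀, ax⟩` (period-generic: the transfers run at every `P`).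
* ★★★ `exists_residB8_slot8κ_of_lettersSrc_γ'_guarded` — the same `(M₁ R : ℕ) (hM₁ : 1 ≤ M₁)` ⊢ the A-5′ (ii) λ-term's body LITERALLY (dag-n24-w1 I.40081 (R1), dag-n05-w1
  I.40099, this seat I.40192): `∃ lam8, ∃ P c₁ ρ₀ ax, (0 < P ∧ M₁ * θ.L ∣ P) ∧ 0 < c₁ ∧ 1 ≤ ρ₀ ∧ B8LeafOfRecordSubBP₂DPerκ θ P M₁ R ⟨lam8.cutSubBP₅ c₁ ρ₀, ax⟩` at `P := M₁·θ.L`.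
HONEST FRAMING: composition BY NAME; 0 estimates of Bałaban's proved here; the letters ∕ sockets are HYPOTHESES at the `Ω₀ = ℤᵈ` law members ([Balaban1985BackgroundPropagators]
content = N06, `m ≥ 1` OPEN; class-wide satisfiability NOT claimed — the J-N06→N05 junction editions of this row are the next modules); the binders are still keyed on the
ℤᵈ (1.5)-index (the outer re-index to `IdxB8SubDPerκ` members at the pinned `M₁` is the generator step after this file); Proposition 7's slot is the display's free
axial-map slot inhabited by a junk map (K1 census, unchanged); count-neutral; **N05 NOT discharged** by this file; K1⁹ NOT claimed; FLAG №10 NOT closed (A-5′ (ii) is dag-n24-w1's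
instance); Bałaban AS PRINTED (Thm 8 SURVIVING form, GAPS G-B8-13; `T_η` read as `P`-periodic data on `ℤᵈ`); one finite 𝕋⁴ programme at fixed ε; nothing continuum ∕ ℝ⁴ ∕ OS ∕
mass-gap ∕ Clay.  No `sorry`, no new definition.  Unit `pub-ymgap-dag-n05-d` (g14).
[cite: Balaban1985RegularSpaces, Lemma 1 – Thm 8 pp.79–101, Prop. 7 (1.144)–(1.145) p.100, (1.3)–(1.5) p.77, p.77 («Ω_j ⊂ T_η»); Balaban1985BackgroundPropagators, Thm 3.1 p.397, Thm 3.3 p.399, (3.40) p.397]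
-/

noncomputable section

namespace Summit.QuantumFields.YangMills.BalabanUVNodes.N05SubBP2DPerKappaSlotExistsGuarded

open Literature.MathematicalPhysics.QuantumFieldTheory.Balaban1983to89
open Literature.MathematicalPhysics.QuantumFieldTheory.Balaban1983to89.Node00
open Literature.MathematicalPhysics.QuantumFieldTheory.Balaban1983to89.B8IdxB8LawsB (IdxB8LawsB IdxB8SubB)
open Literature.MathematicalPhysics.QuantumFieldTheory.Balaban1983to89.B8LeafModelZd (ZdIdx)
open Literature.MathematicalPhysics.QuantumFieldTheory.Balaban1983to89.B8LeafModelZd3 (SockB9P3)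
open Literature.MathematicalPhysics.QuantumFieldTheory.Balaban1983to89.B9SupplySockB9P3ZdGammaUnivDelta2 (SockB9P3H2)
open Literature.MathematicalPhysics.QuantumFieldTheory.Balaban1983to89.B8LeafModelZd3P (zdGF3P zdGF3HP)
open Literature.MathematicalPhysics.QuantumFieldTheory.Balaban1983to89.B8LeafModelZd3P2 (zdGF3P₂ zdGF3HP₂)
open Literature.MathematicalPhysics.QuantumFieldTheory.Balaban1983to89.B8TowerBondsPrinted (towerBondsP)
open Literature.MathematicalPhysics.QuantumFieldTheory.Balaban1983to89.B8SockLettersRD (SockLettersRD)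
open Literature.MathematicalPhysics.QuantumFieldTheory.Balaban1983to89.B8Lemma1NonAbelian (mulCfg blockPairNA)
open Literature.MathematicalPhysics.QuantumFieldTheory.Balaban1983to89.B8LanF146 (LanF146)
open Literature.MathematicalPhysics.QuantumFieldTheory.Balaban1983to89.B8Eq138LandauZd (covLap QT InR138 IsLandau146W)
open Literature.MathematicalPhysics.QuantumFieldTheory.Balaban1983to89.B8Prop5LandauDataZd (ZdLanIdx zdLan)
open Summit.QuantumFields.YangMills.BalabanUVNodes.N05SubBP2DSlotGammaPrime (b8LeafOfRecordSubBP₂D_cutSubBP_zdLan_printCube_of_knit_lettersSrc_γ')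
open MatrixLog B7Prop1Explicit B7Prop2Explicit B7Prop1Local B7Eq92Concrete
open B8Ineq130 (tlo thi)
open B8Ineq132 (InAk covDerivFwd)
open B7Eq78Linearization (zdBlocking QprimeIter)
open B8Eq119TwistedAxial (bgT Restr129 InAx)
open B8Eq140Level (SideTouches)
open B8Eq1117Concrete (XSpace)
open B8Prop5ContractionKLevel (Bd2)
open B8LambdaSpaceKLevel (wt)
open B8Eq184Proof (gaugeExp cfgExp)
open B8Eq146AExpansion (iEta plaqCovDeriv)
open B8Eq143PlaqExpansion (pdiv)
open B7Prop4GeneralLevels (linCovIter)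
open B8Eq155JBound (Jcur wsup)
open B8ScaledSupNorm (bondNorm msup Bdd)
open B9Eq340HolderZd (hquot AdmPair)
-- `Site` alone could resolve to the torus sites of `Setup.lean`; re-export the `ℤ^d` sites of `B7Prop1Explicit`.
export B7Prop1Explicit (Site)
open Literature.MathematicalPhysics.QuantumFieldTheory.Balaban1983to89.B8Prop6PrintedZdCubPGamma (prop6Printed_zdCubP_γ_holds_record_dvd)
open B8ScaledSupNorm (msup_le bdd_of_forall)
open Literature.MathematicalPhysics.QuantumFieldTheory.Balaban1983to89.B8LanF146 (lanF146_zero_iff)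
open Literature.MathematicalPhysics.QuantumFieldTheory.Balaban1983to89.B8Eq138LandauZd (inR138_zero)
open Literature.MathematicalPhysics.QuantumFieldTheory.Balaban1983to89.B8LeafKnitRSC (B8LeafRSC)
open Literature.MathematicalPhysics.QuantumFieldTheory.Balaban1983to89.B8Prop7TowerAxialRecord (toAxialTowerResid)
open Literature.MathematicalPhysics.QuantumFieldTheory.Balaban1983to89.B8LeafModelZdHP2Per (zdGF3HP₂Per)
open Literature.MathematicalPhysics.QuantumFieldTheory.Balaban1983to89.B8Prop7GlevZd3 (one_mulCfg inAk_mono_alpha)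
open B8Eq119TwistedAxial (inAx_self)
open Summit.QuantumFields.YangMills.BalabanUVNodes.N05SubBP2DSlotExistsGuarded (exists_residB8_layer_guarded)
open Summit.QuantumFields.YangMills.BalabanUVNodes.N05SubBP2DPerKappaSlotOfZd (b8LeafOfRecordSubBP₂DPerκ_of_subBP₂D)
open Summit.QuantumFields.YangMills.BalabanUVNodes.N05SubBP2DPerT8SrvGammaPrime (t8P₂DPer_of_lettersSrc_γ')


/-! ## §1. The display's Proposition-7 slot at the periodic δ₂-family: the unit-axial junk witness (census) -/

/-- **(K1)-P-PER CENSUS — the typed Proposition 7 ON THE PERIODIC δ₂-FAMILY does not bind its axial map either.** For the map «return the unperturbed pair `(U₀, 1)`»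
(the constant field `1` is unitary and `P`-periodic): the (1.144)-clause is `U₀ ∈ 𝔄_k(α₀) ⊂ 𝔄_k(α₀ + 3α₂)` and `U₀ ∈ Ax_k(ℭ, U₀)`, the (1.145)-clause in the one-end-point
letter is `‖(Ū₀ʲ)_b − (Ū₀ʲ)_b‖ = 0 ≤ 2α₂` (the periodic member's letters ARE `zdGF3HP₂`'s at the underlying fields; proof = `B8Prop7GlevZd3P.prop7PrintedR_zdGF3P_unitAxial_comp`'s).
CONSEQUENCE (census, not a claim about print): the display's `p7` slot of `B8LeafOfRecordSubBP₂DPer(κ)` holds at this map; it carries content only once `toAxial` is print's.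
[cite: Balaban1985RegularSpaces, Prop. 7 (1.144)–(1.145) p.100 (typed sentence, junk witness), p.77 («Ω_j ⊂ T_η»)] -/
theorem prop7PrintedR_famB8OfRecordSubBP₂DPer_unitAxial (θ : Stage3Params) (β : ℝ) (len : Site θ.D → ℝ) (P : ℕ) :
    B8SectGH.Prop7PrintedR (famB8OfRecordSubBP₂DPer θ β len P)
      (fun _ U₀ _ => (U₀, ⟨1, fun _ _ => (unitaryUnits θ.𝔸).one_mem, fun _ _ => rfl⟩)) := by
  refine ⟨1, one_pos, ?_⟩
  intro j α₀ α₂ _ _ hα₂ _ U₀ _ hInA _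
  refine ⟨⟨rfl, ?_, fun m _ => ?_⟩, fun l _ z μ _ => ?_⟩
  · show InAk θ.L j.1.1.1.1.1.k j.1.1.1.1.1.η (α₀ + 3 * α₂) j.1.1.1.1.1.Ω (mulCfg 1 U₀.1)
    rw [one_mulCfg]
    exact inAk_mono_alpha j.1.1.1.1.1.hη (by linarith) hInA
  · show InAx θ.L m (j.1.1.1.1.1.Λs m) U₀.1 (mulCfg 1 U₀.1)
    rw [one_mulCfg]
    exact inAx_self θ.L m _ U₀.1
  · show ‖((avgIter θ.L (mulCfg 1 U₀.1) l z μ : θ.𝔸ˣ) : θ.𝔸) - ((avgIter θ.L U₀.1 l z μ : θ.𝔸ˣ) : θ.𝔸)‖ ≤ 2 * α₂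
    rw [one_mulCfg, sub_self, norm_zero]
    positivity

/-! ## §2. The guarded κ-periodic slot from the «P₂D» row's letters, at every period and every pinned pair -/

/-- ★★★ **THE GUARDED κ-PERIODIC δ₂-SLOT INHABITED FROM THE «P₂D» ROW's LETTERS, PERIOD-GENERIC** — p638230's guarded root RE-RUN to dag-n05-w1's κ-cut periodic slot:
hypotheses VERBATIM, then `(P M₁ R : ℕ)`; conclusion `∃ lam c₁ ρ₀ ax, 0 < c₁ ∧ 1 ≤ ρ₀ ∧ B8LeafOfRecordSubBP₂DPerκ θ P M₁ R ⟨lam.cutSubBP₅ c₁ ρ₀, ax⟩`.  Proof: the layer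
(`exists_residB8_layer_guarded`), the ℤᵈ «P₂D» slot at the cut (p618522's knit, as in p638230), Theorem 8 surviving at the periodic δ₂-members from the same letters
(`t8P₂DPer_of_lettersSrc_γ'`), the unit-axial Proposition-7 witness (§1), FILE 1's `b8LeafOfRecordSubBP₂DPerκ_of_subBP₂D` (transfer′ for Thms 2 ∕ 4, P1′'s pure-∀ transfer
for Prop. 3, K2's restriction).  Sockets ∕ letters are HYPOTHESES (N06); N05 NOT discharged.
[cite: Balaban1985RegularSpaces, Lemma 1 – Thm 8 pp.79–101, Prop. 5 (1.106)–(1.110) p.94, (1.3)–(1.5) p.77, p.77 («Ω_j ⊂ T_η»); Balaban1985BackgroundPropagators, Thm 3.1 p.397, Thm 3.3 p.399, (3.40) p.397] -/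
theorem exists_residB8_b8LeafOfRecordSubBP₂DPerκ_cutSubBP₅_of_lettersSrc_γ'_guarded (θ : Stage3Params) (hD : 2 ≤ θ.D) (hL5 : 5 ≤ θ.L)
    -- [Balaban1985BackgroundPropagators]'s PRIMITIVE constants read by the sockets: `B₀` (3.40), the Hölder pair `(β, B₀(β₀))` and length function, [4]'s letter bounds
    {B₀ B₀β β : ℝ} {len : Site θ.D → ℝ}
    {cB9 B₀'H B₂' BG BR cL : ℝ}
    (hcB9 : 0 < cB9) (hB₀'H : 0 < B₀'H) (hB₂' : 0 ≤ B₂') (hBG : 0 ≤ BG) (hBR : 0 ≤ BR) (hcL : 0 < cL)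
    -- [4]'s letters AT THE `Ω₀ = ℤᵈ` LAW MEMBERS ONLY: existence side (laws on print's domains) and uniqueness side
    (SLet : ∀ i : ZdIdx θ.D θ.L, i.Ω 0 = Set.univ → IdxB8LawsB θ.L i → B8ConstraintBonds.DomainSeq θ.L i.Ω → (∀ l, l < i.k → ∀ z ∈ i.Λs i.k l, ((θ.L : ℤ) ^ l) • z ∈ B8ConstraintBonds.Lam θ.L i.Ω l) → SockLettersRD (𝔸 := θ.𝔸) θ.L BG BR B₀'H B₂' cL i.η i.k i.Ω i.Λs)
    (SLetUB : ∀ i : ZdIdx θ.D θ.L, i.Ω 0 = Set.univ → IdxB8LawsB θ.L i → B8ConstraintBonds.DomainSeq θ.L i.Ω → (∀ l, l < i.k → ∀ z ∈ i.Λs i.k l, ((θ.L : ℤ) ^ l) • z ∈ B8ConstraintBonds.Lam θ.L i.Ω l) → ∀ α₀ : ℝ, 0 < α₀ → α₀ ≤ cL → ∀ U₀ : Site θ.D → Fin θ.D → θ.𝔸ˣ, (∀ x κ, U₀ x κ ∈ unitaryUnits θ.𝔸) →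
      InAk θ.L i.k i.η α₀ i.Ω U₀ →
      ∃ (g Δ : (Site θ.D → θ.𝔸) →ₗ[ℂ] (Site θ.D → θ.𝔸)) (q : (Site θ.D → θ.𝔸) →ₗ[ℂ] (ℕ → Site θ.D → θ.𝔸))
        (qs : (ℕ → Site θ.D → θ.𝔸) →ₗ[ℂ] (Site θ.D → θ.𝔸)) (Aw c : (ℕ → Site θ.D → θ.𝔸) →ₗ[ℂ] (ℕ → Site θ.D → θ.𝔸))
        (H' : XSpace θ.D i.k θ.𝔸 →ₗ[ℂ] (Site θ.D → θ.𝔸)),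
        (∀ x : Site θ.D → θ.𝔸, (∃ C : ℝ, ∀ y, ‖x y‖ ≤ C) → g (Δ x + qs (Aw (q x))) = x) ∧ (∀ φ, qs (c (q (g (g (qs φ))))) = qs φ) ∧
        (∀ (f : Site θ.D → θ.𝔸), ∀ x ∈ i.Ω 0, Δ f x = covLap i.η U₀ ((i.Ω 0).indicator f) x) ∧
        (∀ (μ : ℕ → Site θ.D → θ.𝔸), ∀ x ∈ i.Ω 0, qs μ x = QT θ.L i.k (i.Λs i.k) U₀ μ x) ∧
        (∀ (f : Site θ.D → θ.𝔸) (n : ℕ), n ≤ i.k → ∀ y ∈ i.Λs i.k n, q f n y = QprimeIter (zdBlocking θ.D θ.L) (bgT θ.L U₀) n f y) ∧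
        (∀ (f : Site θ.D → θ.𝔸) (n : ℕ) (y : Site θ.D), ¬ (n ≤ i.k ∧ y ∈ i.Λs i.k n) → q f n y = 0) ∧
        (∀ (X : XSpace θ.D i.k θ.𝔸) (x : Site θ.D), ‖H' X x‖ ≤ B₀'H * ‖X‖) ∧
        (∀ n, n ≤ i.k → ∀ (X : XSpace θ.D i.k θ.𝔸), ∀ p ∈ {b : Site θ.D × Fin θ.D | SideTouches (i.Ω n) b.1 b.2},
          wt θ.L i.η n * ‖covDerivFwd i.η U₀ p.2 (H' X) p.1‖ ≤ B₀'H * ‖X‖) ∧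
        (∀ X : XSpace θ.D i.k θ.𝔸, Bd2 θ.L i.η i.k i.Ω (covLap i.η U₀ (H' X)) (B₂' * ‖X‖)) ∧
        (∀ (Y : XSpace θ.D i.k θ.𝔸) (n : ℕ) (hn : n ≤ i.k) (y : Site θ.D), y ∈ i.Λs i.k n →
          QprimeIter (zdBlocking θ.D θ.L) (bgT θ.L U₀) n (H' Y) y = Y (⟨n, Nat.lt_succ_of_le hn⟩, y)) ∧
        (∀ (f : Site θ.D → θ.𝔸) (r : ℝ), 0 ≤ r → Bd2 θ.L i.η i.k i.Ω f r →
          (∀ x, ‖g f x‖ ≤ BG * r) ∧ ∀ n, n ≤ i.k → ∀ p ∈ {b : Site θ.D × Fin θ.D | SideTouches (i.Ω n) b.1 b.2},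
            wt θ.L i.η n * ‖covDerivFwd i.η U₀ p.2 (g f) p.1‖ ≤ BG * r) ∧
        (∀ (f : Site θ.D → θ.𝔸) (r : ℝ), 0 ≤ r → Bd2 θ.L i.η i.k i.Ω f r → Bd2 θ.L i.η i.k i.Ω (f - g (qs (c (q (g f))))) (BR * r)))
    -- the SOURCELESS b9 socket of Proposition 3's frame over PRINT's class, at the law members only ([4] Thm 3.3; threshold `cB9`) — for Prop. 3 AS PRINTED
    (SB9P : ∀ i : ZdIdx θ.D θ.L, i.Ω 0 = Set.univ → IdxB8LawsB θ.L i → B8ConstraintBonds.DomainSeq θ.L i.Ω → (∀ l, l < i.k → ∀ z ∈ i.Λs i.k l, ((θ.L : ℤ) ^ l) • z ∈ B8ConstraintBonds.Lam θ.L i.Ω l) →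
      SockB9P3H2 (𝔸 := θ.𝔸) θ.L B₀ B₀β cB9 β len i.η i.k i.Ω i.Λs (fun m j => towerBondsP θ.L i.Ω (i.Λs m) j))
    -- THEOREM 8's SOCKET-SIDE constants (source threshold `cP3`, source size factor `γ₈`, remainder slacks `γ′ γ″ γβ`) and the guard `2 ≤ 5dLB₀` on [4]'s `B₀` —
    -- NO layer equation, NO auxiliary `B₈ ∕ B₈β`, NO free-constant guard: those are CHOSEN ∕ DERIVED in the proof
    {cP3 γ₈ γ' γ'' γβ : ℝ} (hcP3 : 0 < cP3) (hγ₈ : 1 ≤ γ₈) (hγ' : 0 ≤ γ') (hγ'' : 0 ≤ γ'')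
    (hB : 2 ≤ 5 * (θ.D : ℝ) * θ.L * B₀) (hB₀β : 0 < B₀β)
    -- [Balaban1985BackgroundPropagators] Thm 3.3 WITH SOURCE in Theorem 4's frame at (1.146), γ′ letter, at the law members ONLY, asked RADIUS-UNIFORMLY: for every
    -- gauge-field radius scale `r ≥ 0` SOME threshold `c59 > 0` (print needs the one radius `r = O(B₁)`; [4] Thm 3.3 gives every `r` by shrinking its threshold) — HYPOTHESIS
    (SH59src : ∀ r : ℝ, 0 ≤ r → ∃ c59 : ℝ, 0 < c59 ∧ ∀ i : ZdIdx θ.D θ.L, i.Ω 0 = Set.univ → IdxB8LawsB θ.L i → B8ConstraintBonds.DomainSeq θ.L i.Ω → (∀ l, l < i.k → ∀ z ∈ i.Λs i.k l, ((θ.L : ℤ) ^ l) • z ∈ B8ConstraintBonds.Lam θ.L i.Ω l) → ∀ α₀ α₁ : ℝ, 0 < α₀ → 0 < α₁ → α₀ + α₁ ≤ c59 →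
      ∀ U₀ U' : Site θ.D → Fin θ.D → θ.𝔸ˣ, (∀ x κ, U₀ x κ ∈ unitaryUnits θ.𝔸) → (∀ x κ, U' x κ ∈ unitaryUnits θ.𝔸) →
      ∀ φ : Site θ.D → θ.𝔸, ((InR138 θ.L i.k i.η (i.Ω 0) (i.Λs i.k) U₀ φ ∧ (∀ x, IsSelfAdjoint (φ x)) ∧ (∀ x, x ∉ i.Ω 0 → φ x = 0) ∧
          Bdd θ.L i.k i.η (-(2 : ℝ)) (fun j (x : Site θ.D) => x ∈ i.Ω j) φ) ∧
        msup θ.L i.k i.η (-(2 : ℝ)) (fun j (x : Site θ.D) => x ∈ i.Ω j) φ < γ₈ * (α₀ + α₁)) →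
      InAk θ.L i.k i.η α₀ i.Ω U₀ → InAk θ.L i.k i.η α₀ i.Ω (mulCfg U' U₀) → (∀ m, m ≤ i.k → InAx θ.L m (i.Λs m) U₀ (mulCfg U' U₀)) →
      (∀ j, j ≤ i.k → ∀ (z : Site θ.D) (μ : Fin θ.D),
        ((∀ x, InBox (tlo θ.L z j) (thi θ.L z j) x → x ∈ i.Ω j) ∨ (∀ x, InBox (tlo θ.L (z + e μ) j) (thi θ.L (z + e μ) j) x → x ∈ i.Ω j)) →
        ‖(avgIter θ.L (mulCfg U' U₀) j z μ : θ.𝔸) - (avgIter θ.L U₀ j z μ : θ.𝔸)‖ ≤ α₁) →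
      (∀ b ∈ {b : Site θ.D × Fin θ.D | SideTouches (i.Ω 0) b.1 b.2}, ‖((U' b.1 b.2 : θ.𝔸ˣ) : θ.𝔸) - 1‖ ≤ α₁) →
      (∀ m, 1 ≤ m → m ≤ i.k → ∀ (u : Site θ.D → θ.𝔸ˣ) (W : Site θ.D → Fin θ.D → θ.𝔸ˣ) (A' : Site θ.D → Fin θ.D → θ.𝔸),
        (∀ x, u x ∈ unitaryUnits θ.𝔸) → mgauge U₀ u W = U' → Restr129 θ.L m (i.Λs m) U₀ u → LanF146 θ.L i.k i.η (i.Ω 0) i.Λs U₀ φ m W →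
        (∀ y τ, IsSelfAdjoint (A' y τ)) →
        (∀ j, j ≤ m → ∀ y τ, SideTouches (i.Ω j) y τ →
        W y τ = cfgExp i.η A' y τ ∧ ‖A' y τ‖ ≤ r * (α₀ + α₁) * ((θ.L : ℝ) ^ j * i.η)⁻¹) →
        (∀ y τ, (∀ j, j ≤ m → ¬ SideTouches (i.Ω j) y τ) → A' y τ = 0) →
        msup θ.L m i.η (-(1 : ℝ)) (fun j (b : Site θ.D × Fin θ.D) => SideTouches (i.Ω j) b.1 b.2) (fun b => A' b.1 b.2)
        ≤ B₀ * (bondNorm θ.L m i.η (-(3 : ℝ)) i.Ω (fun x μ => Jcur i.η U₀ A' μ x)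
        + wsup 1 (fun p : {p : ℕ × (Site θ.D × Fin θ.D) // p.1 ≤ m ∧ p.2 ∈ towerBondsP θ.L i.Ω (i.Λs m) p.1} =>
        linCovIter θ.L U₀ (iEta i.η A') p.1.1 p.1.2.1 p.1.2.2)) + γ' * B₀ * (α₀ + α₁) ∧
        msup θ.L m i.η (-(2 : ℝ)) (fun j (t : Fin θ.D × Fin θ.D × Site θ.D) => SideTouches (i.Ω j) t.2.2 t.2.1)
        (fun t => covDerivFwd i.η U₀ t.1 (fun z => A' z t.2.1) t.2.2)
        ≤ B₀ * (bondNorm θ.L m i.η (-(3 : ℝ)) i.Ω (fun x μ => Jcur i.η U₀ A' μ x)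
        + wsup 1 (fun p : {p : ℕ × (Site θ.D × Fin θ.D) // p.1 ≤ m ∧ p.2 ∈ towerBondsP θ.L i.Ω (i.Λs m) p.1} =>
        linCovIter θ.L U₀ (iEta i.η A') p.1.1 p.1.2.1 p.1.2.2)) + γ' * B₀ * (α₀ + α₁)))
    -- THE SOURCED b9 SOCKET OF PROPOSITION 3's FRAME at the `Ω₀ = ℤᵈ` law members, threshold `cP3`, `|B₁|` over print's class at the top truncation — HYPOTHESIS
    -- ([Balaban1985BackgroundPropagators] Thm 3.3 with source; = `B8Prop3SrcZd3HPGamma`'s input letter for letter)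
    (SB9srcHP : ∀ i : ZdIdx θ.D θ.L, i.Ω 0 = Set.univ → IdxB8LawsB θ.L i → B8ConstraintBonds.DomainSeq θ.L i.Ω → (∀ l, l < i.k → ∀ z ∈ i.Λs i.k l, ((θ.L : ℤ) ^ l) • z ∈ B8ConstraintBonds.Lam θ.L i.Ω l) → ∀ α₀ α₁ α₂ : ℝ, 0 < α₀ → α₀ ≤ cP3 → 0 < α₁ → 0 < α₂ → α₂ ≤ cP3 →
      ∀ (U₀ W : Site θ.D → Fin θ.D → θ.𝔸ˣ), (∀ x κ, U₀ x κ ∈ unitaryUnits θ.𝔸) → (∀ x κ, W x κ ∈ unitaryUnits θ.𝔸) →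
      ∀ f : Site θ.D → θ.𝔸, InR138 θ.L i.k i.η (i.Ω 0) (i.Λs i.k) U₀ f →
      (∀ x, IsSelfAdjoint (f x)) → (∀ x, x ∉ i.Ω 0 → f x = 0) →
      Bdd θ.L i.k i.η (-(2 : ℝ)) (fun j (x : Site θ.D) => x ∈ i.Ω j) f →
      msup θ.L i.k i.η (-(2 : ℝ)) (fun j (x : Site θ.D) => x ∈ i.Ω j) f < γ₈ * (α₀ + α₁) →
      msup θ.L i.k i.η (-(3 : ℝ)) (fun j (p : Fin θ.D × Site θ.D) => p.2 ∈ i.Ω j) (fun p => covDerivFwd i.η U₀ p.1 f p.2) < γ₈ * (α₀ + α₁) →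
      InAk θ.L i.k i.η α₀ i.Ω U₀ → InAk θ.L i.k i.η α₀ i.Ω (mulCfg W U₀) → IsLandau146W θ.L i.k i.η (i.Ω 0) (i.Λs i.k) U₀ f W →
      ∀ A' : Site θ.D → Fin θ.D → θ.𝔸, (∀ y τ, IsSelfAdjoint (A' y τ)) →
      (∀ j, j ≤ i.k → ∀ (y : Site θ.D) (τ : Fin θ.D), SideTouches (i.Ω j) y τ →
        W y τ = cfgExp i.η A' y τ ∧ ‖A' y τ‖ ≤ α₂ * ((θ.L : ℝ) ^ j * i.η)⁻¹) →
      (∀ (y : Site θ.D) (τ : Fin θ.D), (∀ j, j ≤ i.k → ¬ SideTouches (i.Ω j) y τ) → A' y τ = 0) →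
      msup θ.L i.k i.η (-(1 : ℝ)) (fun j (b : Site θ.D × Fin θ.D) => SideTouches (i.Ω j) b.1 b.2) (fun b => A' b.1 b.2)
          ≤ B₀ * (bondNorm θ.L i.k i.η (-(3 : ℝ)) i.Ω (fun x μ => Jcur i.η U₀ A' μ x)
            + wsup 1 (fun p : {p : ℕ × (Site θ.D × Fin θ.D) // p.1 ≤ i.k ∧ p.2 ∈ towerBondsP θ.L i.Ω (i.Λs i.k) p.1} =>
                linCovIter θ.L U₀ (iEta i.η A') p.1.1 p.1.2.1 p.1.2.2)) + γ'' * B₀ * (α₀ + α₁) ∧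
        msup θ.L i.k i.η (-(2 : ℝ)) (fun j (t : Fin θ.D × Fin θ.D × Site θ.D) => SideTouches (i.Ω j) t.2.2 t.2.1)
            (fun t => covDerivFwd i.η U₀ t.1 (fun z => A' z t.2.1) t.2.2)
          ≤ B₀ * (bondNorm θ.L i.k i.η (-(3 : ℝ)) i.Ω (fun x μ => Jcur i.η U₀ A' μ x)
            + wsup 1 (fun p : {p : ℕ × (Site θ.D × Fin θ.D) // p.1 ≤ i.k ∧ p.2 ∈ towerBondsP θ.L i.Ω (i.Λs i.k) p.1} =>
                linCovIter θ.L U₀ (iEta i.η A') p.1.1 p.1.2.1 p.1.2.2)) + γ'' * B₀ * (α₀ + α₁) ∧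
        bondNorm θ.L i.k i.η (-(3 : ℝ)) i.Ω (fun x μ => pdiv i.η U₀ (plaqCovDeriv i.η U₀ A') μ x)
          ≤ B₀ * (bondNorm θ.L i.k i.η (-(3 : ℝ)) i.Ω (fun x μ => Jcur i.η U₀ A' μ x)
            + wsup 1 (fun p : {p : ℕ × (Site θ.D × Fin θ.D) // p.1 ≤ i.k ∧ p.2 ∈ towerBondsP θ.L i.Ω (i.Λs i.k) p.1} =>
                linCovIter θ.L U₀ (iEta i.η A') p.1.1 p.1.2.1 p.1.2.2)) + γ'' * B₀ * (α₀ + α₁) ∧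
        bondNorm θ.L i.k i.η (-(3 : ℝ)) i.Ω (fun x μ => covLap i.η U₀ (fun z => A' z μ) x)
          ≤ B₀ * (bondNorm θ.L i.k i.η (-(3 : ℝ)) i.Ω (fun x μ => Jcur i.η U₀ A' μ x)
            + wsup 1 (fun p : {p : ℕ × (Site θ.D × Fin θ.D) // p.1 ≤ i.k ∧ p.2 ∈ towerBondsP θ.L i.Ω (i.Λs i.k) p.1} =>
                linCovIter θ.L U₀ (iEta i.η A') p.1.1 p.1.2.1 p.1.2.2)) + γ'' * B₀ * (α₀ + α₁) ∧
        msup θ.L i.k i.η (-(2 + β)) (fun j (q : Fin θ.D × Fin θ.D × (Site θ.D × Site θ.D)) => q.2.2 ∈ AdmPair i.η len ∧ q.2.2.1 ∈ i.Ω j ∧ q.2.2.2 ∈ i.Ω j)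
            (fun q => hquot i.η β len U₀ (covDerivFwd i.η U₀ q.1 (fun z => A' z q.2.1)) q.2.2)
          ≤ B₀β * (bondNorm θ.L i.k i.η (-(3 : ℝ)) i.Ω (fun x μ => Jcur i.η U₀ A' μ x)
            + wsup 1 (fun p : {p : ℕ × (Site θ.D × Fin θ.D) // p.1 ≤ i.k ∧ p.2 ∈ towerBondsP θ.L i.Ω (i.Λs i.k) p.1} =>
                linCovIter θ.L U₀ (iEta i.η A') p.1.1 p.1.2.1 p.1.2.2)) + γβ * (α₀ + α₁))
    (P M₁ R : ℕ) :
    ∃ (lam : ResidB8 θ) (c₁ : ℝ) (ρ₀ : ℕ)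
      (ax : ∀ j : IdxB8SubDPer θ P, (famB8OfRecordPer θ (lam.cutSubBP₅ c₁ ρ₀).β (lam.cutSubBP₅ c₁ ρ₀).len P j).Cfg →
        (famB8OfRecordPer θ (lam.cutSubBP₅ c₁ ρ₀).β (lam.cutSubBP₅ c₁ ρ₀).len P j).Pert → (famB8OfRecordPer θ (lam.cutSubBP₅ c₁ ρ₀).β (lam.cutSubBP₅ c₁ ρ₀).len P j).Pert),
      0 < c₁ ∧ 1 ≤ ρ₀ ∧ B8LeafOfRecordSubBP₂DPerκ θ P M₁ R ⟨lam.cutSubBP₅ c₁ ρ₀, ax⟩ := by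
  -- the chosen constants and layer, GUARDED (p638230 §1: `1 ≤ ρ₀`, `0 < c₁⋆` kept)
  obtain ⟨ρ₀, B₁s, c₁s, B₈, B₈β, lam, hρ₀, hc₁s, hP6, rfl, rfl, rfl, rfl, hC₂eq, hB₁', hB₁eq, hB₂eq, hB₁big, -, hB₀8, hγB, hγB'', hB8β, hfree2, hfreeS, hr0⟩ :=
    exists_residB8_layer_guarded θ hD hL5 (β := β) (len := len) (B₀β := B₀β) hBG hBR γβ hγ₈ hγ' hγ'' hB
  obtain ⟨c59, hc59, SH⟩ := SH59src _ hr0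
  -- THE ℤᵈ «P₂D» SLOT at dag-n05-w1's print-class cut (p638230's body VERBATIM)
  have hzd : B8LeafOfRecordSubBP₂D θ (lam.cutSubBP₅ c₁s ρ₀) := by
    refine (b8LeafOfRecordSubBP₂D_cutSubBP₅_iff_cutSubBP lam c₁s ρ₀).2 ?_
    refine b8LeafOfRecordSubBP₂D_cutSubBP_zdLan_printCube_of_knit_lettersSrc_γ' lam hD hC₂eq hcB9 hB₀'H hB₂' hBG hBR hcL SLet SLetUB SB9P hfree2
        IdxB8LanC.toZdLanIdx IdxB8LanC.hΩ0L IdxB8LanC.hΩL IdxB8LanC.htowerL ?_ ?_ hP6 hB₁big hc59 hcP3 hγ₈ hγ' hγ'' hB hB₀β hB₀8 hγB hγB'' hB8β hB₁' hB₁eq hB₂eq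
        hfreeS
        (fun i hΩ hl hd hlt α₀ α₁ hα₀ hα₁ hαc U₀ U' hU₀ hU' φ hφ hIn hIn' hAx h135 hbd m hm1 hmk u W A' hu hg hR hLan hsa hW hA0 =>
          SH i hΩ hl hd hlt α₀ α₁ hα₀ hα₁ hαc U₀ U' hU₀ hU' φ hφ hIn hIn' hAx h135 hbd m hm1 hmk u W A' hu hg hR hLan hsa
            (fun j hj y τ hst => ⟨(hW j hj y τ hst).1, (hW j hj y τ hst).2.trans_eq (by ring)⟩) hA0)
        SB9srcHP
    · intro a α₀ hα₀ hαL hIn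
      exact SLet a.mem.1.1.1.1 a.mem.1.1.1.2 a.mem.1.1.2 a.mem.1.2 a.mem.2 α₀ hα₀ hαL a.U₀ a.hU₀ hIn a.mem.1.1.1.1.k a.mem.1.1.1.1.hk le_rfl
    · intro a α₀ hα₀ hαL hIn
      exact SLetUB a.mem.1.1.1.1 a.mem.1.1.1.2 a.mem.1.1.2 a.mem.1.2 a.mem.2 α₀ hα₀ hαL a.U₀ a.hU₀ hIn
  -- THEOREM 8 SURVIVING AT THE PERIODIC δ₂-MEMBERS, from the SAME letters (CLAIM-7's periodic server under this seat's periodic T8 knit)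
  have t8Per := t8P₂DPer_of_lettersSrc_γ' lam P hD hB₀'H hB₂' hBG hBR hcL SLet SLetUB hc59 hcP3 hγ₈ hγ' hγ'' hB hB₀β hB₀8 hγB hγB'' hB8β hB₁eq hB₂eq hfreeS
    (fun i hΩ hl hd hlt α₀ α₁ hα₀ hα₁ hαc U₀ U' hU₀ hU' φ hφ hIn hIn' hAx h135 hbd m hm1 hmk u W A' hu hg hR hLan hsa hW hA0 =>
      SH i hΩ hl hd hlt α₀ α₁ hα₀ hα₁ hαc U₀ U' hU₀ hU' φ hφ hIn hIn' hAx h135 hbd m hm1 hmk u W A' hu hg hR hLan hsa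
        (fun j hj y τ hst => ⟨(hW j hj y τ hst).1, (hW j hj y τ hst).2.trans_eq (by ring)⟩) hA0)
    SB9srcHP
  -- the periodic layer at the unit-axial map, FILE 1 (transfer′ + P1′ + K2) with §1's Proposition-7 witness
  refine ⟨lam, c₁s, ρ₀, fun _ U₀ _ => (U₀, ⟨1, fun _ _ => (unitaryUnits θ.𝔸).one_mem, fun _ _ => rfl⟩), hc₁s, hρ₀, ?_⟩
  exact b8LeafOfRecordSubBP₂DPerκ_of_subBP₂D M₁ R _ hzd t8Per (prop7PrintedR_famB8OfRecordSubBP₂DPer_unitAxial θ _ _ P)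

/-- ★★★ **THE A-5′ (ii) λ-TERM's BODY, LITERALLY** (dag-n24-w1 PRE-CLAIM-4 (R1) ∕ dag-n05-w1 WORD ∕ this seat's WORD, cell bus 2026-08-28 15:0x–15:09Z): at the outer-pinned
pair `(M₁, R)` with `1 ≤ M₁`, p638230's hypotheses VERBATIM ⊢ `∃ lam8, ∃ P c₁ ρ₀ ax, (0 < P ∧ M₁ * θ.L ∣ P) ∧ 0 < c₁ ∧ 1 ≤ ρ₀ ∧ B8LeafOfRecordSubBP₂DPerκ θ P M₁ R ⟨lam8.cutSubBP₅ c₁ ρ₀, ax⟩`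
— the period-generic theorem at `P := M₁·θ.L` (`0 < P` from `1 ≤ M₁`, `2 ≤ θ.L`).  This is `∃ lam8, Slot8κ M₁ R θ lam8` β-reduced, the supplier shape the ONE Part-37 closer
instance of A-5′ (ii) reads; the binders are still the ℤᵈ-keyed letters (outer re-index = next module).
[cite: Balaban1985RegularSpaces, Lemma 1 – Thm 8 pp.79–101, (1.3)–(1.5) p.77, p.77 («Ω_j ⊂ T_η»); Balaban1985BackgroundPropagators, Thm 3.1 p.397, Thm 3.3 p.399] -/
theorem exists_residB8_slot8κ_of_lettersSrc_γ'_guarded (θ : Stage3Params) (hD : 2 ≤ θ.D) (hL5 : 5 ≤ θ.L)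
    -- [Balaban1985BackgroundPropagators]'s PRIMITIVE constants read by the sockets: `B₀` (3.40), the Hölder pair `(β, B₀(β₀))` and length function, [4]'s letter bounds
    {B₀ B₀β β : ℝ} {len : Site θ.D → ℝ}
    {cB9 B₀'H B₂' BG BR cL : ℝ}
    (hcB9 : 0 < cB9) (hB₀'H : 0 < B₀'H) (hB₂' : 0 ≤ B₂') (hBG : 0 ≤ BG) (hBR : 0 ≤ BR) (hcL : 0 < cL)
    -- [4]'s letters AT THE `Ω₀ = ℤᵈ` LAW MEMBERS ONLY: existence side (laws on print's domains) and uniqueness side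
    (SLet : ∀ i : ZdIdx θ.D θ.L, i.Ω 0 = Set.univ → IdxB8LawsB θ.L i → B8ConstraintBonds.DomainSeq θ.L i.Ω → (∀ l, l < i.k → ∀ z ∈ i.Λs i.k l, ((θ.L : ℤ) ^ l) • z ∈ B8ConstraintBonds.Lam θ.L i.Ω l) → SockLettersRD (𝔸 := θ.𝔸) θ.L BG BR B₀'H B₂' cL i.η i.k i.Ω i.Λs)
    (SLetUB : ∀ i : ZdIdx θ.D θ.L, i.Ω 0 = Set.univ → IdxB8LawsB θ.L i → B8ConstraintBonds.DomainSeq θ.L i.Ω → (∀ l, l < i.k → ∀ z ∈ i.Λs i.k l, ((θ.L : ℤ) ^ l) • z ∈ B8ConstraintBonds.Lam θ.L i.Ω l) → ∀ α₀ : ℝ, 0 < α₀ → α₀ ≤ cL → ∀ U₀ : Site θ.D → Fin θ.D → θ.𝔸ˣ, (∀ x κ, U₀ x κ ∈ unitaryUnits θ.𝔸) →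
      InAk θ.L i.k i.η α₀ i.Ω U₀ →
      ∃ (g Δ : (Site θ.D → θ.𝔸) →ₗ[ℂ] (Site θ.D → θ.𝔸)) (q : (Site θ.D → θ.𝔸) →ₗ[ℂ] (ℕ → Site θ.D → θ.𝔸))
        (qs : (ℕ → Site θ.D → θ.𝔸) →ₗ[ℂ] (Site θ.D → θ.𝔸)) (Aw c : (ℕ → Site θ.D → θ.𝔸) →ₗ[ℂ] (ℕ → Site θ.D → θ.𝔸))
        (H' : XSpace θ.D i.k θ.𝔸 →ₗ[ℂ] (Site θ.D → θ.𝔸)),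
        (∀ x : Site θ.D → θ.𝔸, (∃ C : ℝ, ∀ y, ‖x y‖ ≤ C) → g (Δ x + qs (Aw (q x))) = x) ∧ (∀ φ, qs (c (q (g (g (qs φ))))) = qs φ) ∧
        (∀ (f : Site θ.D → θ.𝔸), ∀ x ∈ i.Ω 0, Δ f x = covLap i.η U₀ ((i.Ω 0).indicator f) x) ∧
        (∀ (μ : ℕ → Site θ.D → θ.𝔸), ∀ x ∈ i.Ω 0, qs μ x = QT θ.L i.k (i.Λs i.k) U₀ μ x) ∧
        (∀ (f : Site θ.D → θ.𝔸) (n : ℕ), n ≤ i.k → ∀ y ∈ i.Λs i.k n, q f n y = QprimeIter (zdBlocking θ.D θ.L) (bgT θ.L U₀) n f y) ∧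
        (∀ (f : Site θ.D → θ.𝔸) (n : ℕ) (y : Site θ.D), ¬ (n ≤ i.k ∧ y ∈ i.Λs i.k n) → q f n y = 0) ∧
        (∀ (X : XSpace θ.D i.k θ.𝔸) (x : Site θ.D), ‖H' X x‖ ≤ B₀'H * ‖X‖) ∧
        (∀ n, n ≤ i.k → ∀ (X : XSpace θ.D i.k θ.𝔸), ∀ p ∈ {b : Site θ.D × Fin θ.D | SideTouches (i.Ω n) b.1 b.2},
          wt θ.L i.η n * ‖covDerivFwd i.η U₀ p.2 (H' X) p.1‖ ≤ B₀'H * ‖X‖) ∧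
        (∀ X : XSpace θ.D i.k θ.𝔸, Bd2 θ.L i.η i.k i.Ω (covLap i.η U₀ (H' X)) (B₂' * ‖X‖)) ∧
        (∀ (Y : XSpace θ.D i.k θ.𝔸) (n : ℕ) (hn : n ≤ i.k) (y : Site θ.D), y ∈ i.Λs i.k n →
          QprimeIter (zdBlocking θ.D θ.L) (bgT θ.L U₀) n (H' Y) y = Y (⟨n, Nat.lt_succ_of_le hn⟩, y)) ∧
        (∀ (f : Site θ.D → θ.𝔸) (r : ℝ), 0 ≤ r → Bd2 θ.L i.η i.k i.Ω f r →
          (∀ x, ‖g f x‖ ≤ BG * r) ∧ ∀ n, n ≤ i.k → ∀ p ∈ {b : Site θ.D × Fin θ.D | SideTouches (i.Ω n) b.1 b.2},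
            wt θ.L i.η n * ‖covDerivFwd i.η U₀ p.2 (g f) p.1‖ ≤ BG * r) ∧
        (∀ (f : Site θ.D → θ.𝔸) (r : ℝ), 0 ≤ r → Bd2 θ.L i.η i.k i.Ω f r → Bd2 θ.L i.η i.k i.Ω (f - g (qs (c (q (g f))))) (BR * r)))
    -- the SOURCELESS b9 socket of Proposition 3's frame over PRINT's class, at the law members only ([4] Thm 3.3; threshold `cB9`) — for Prop. 3 AS PRINTED
    (SB9P : ∀ i : ZdIdx θ.D θ.L, i.Ω 0 = Set.univ → IdxB8LawsB θ.L i → B8ConstraintBonds.DomainSeq θ.L i.Ω → (∀ l, l < i.k → ∀ z ∈ i.Λs i.k l, ((θ.L : ℤ) ^ l) • z ∈ B8ConstraintBonds.Lam θ.L i.Ω l) →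
      SockB9P3H2 (𝔸 := θ.𝔸) θ.L B₀ B₀β cB9 β len i.η i.k i.Ω i.Λs (fun m j => towerBondsP θ.L i.Ω (i.Λs m) j))
    -- THEOREM 8's SOCKET-SIDE constants (source threshold `cP3`, source size factor `γ₈`, remainder slacks `γ′ γ″ γβ`) and the guard `2 ≤ 5dLB₀` on [4]'s `B₀` —
    -- NO layer equation, NO auxiliary `B₈ ∕ B₈β`, NO free-constant guard: those are CHOSEN ∕ DERIVED in the proof
    {cP3 γ₈ γ' γ'' γβ : ℝ} (hcP3 : 0 < cP3) (hγ₈ : 1 ≤ γ₈) (hγ' : 0 ≤ γ') (hγ'' : 0 ≤ γ'')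
    (hB : 2 ≤ 5 * (θ.D : ℝ) * θ.L * B₀) (hB₀β : 0 < B₀β)
    -- [Balaban1985BackgroundPropagators] Thm 3.3 WITH SOURCE in Theorem 4's frame at (1.146), γ′ letter, at the law members ONLY, asked RADIUS-UNIFORMLY: for every
    -- gauge-field radius scale `r ≥ 0` SOME threshold `c59 > 0` (print needs the one radius `r = O(B₁)`; [4] Thm 3.3 gives every `r` by shrinking its threshold) — HYPOTHESIS
    (SH59src : ∀ r : ℝ, 0 ≤ r → ∃ c59 : ℝ, 0 < c59 ∧ ∀ i : ZdIdx θ.D θ.L, i.Ω 0 = Set.univ → IdxB8LawsB θ.L i → B8ConstraintBonds.DomainSeq θ.L i.Ω → (∀ l, l < i.k → ∀ z ∈ i.Λs i.k l, ((θ.L : ℤ) ^ l) • z ∈ B8ConstraintBonds.Lam θ.L i.Ω l) → ∀ α₀ α₁ : ℝ, 0 < α₀ → 0 < α₁ → α₀ + α₁ ≤ c59 →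
      ∀ U₀ U' : Site θ.D → Fin θ.D → θ.𝔸ˣ, (∀ x κ, U₀ x κ ∈ unitaryUnits θ.𝔸) → (∀ x κ, U' x κ ∈ unitaryUnits θ.𝔸) →
      ∀ φ : Site θ.D → θ.𝔸, ((InR138 θ.L i.k i.η (i.Ω 0) (i.Λs i.k) U₀ φ ∧ (∀ x, IsSelfAdjoint (φ x)) ∧ (∀ x, x ∉ i.Ω 0 → φ x = 0) ∧
          Bdd θ.L i.k i.η (-(2 : ℝ)) (fun j (x : Site θ.D) => x ∈ i.Ω j) φ) ∧
        msup θ.L i.k i.η (-(2 : ℝ)) (fun j (x : Site θ.D) => x ∈ i.Ω j) φ < γ₈ * (α₀ + α₁)) →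
      InAk θ.L i.k i.η α₀ i.Ω U₀ → InAk θ.L i.k i.η α₀ i.Ω (mulCfg U' U₀) → (∀ m, m ≤ i.k → InAx θ.L m (i.Λs m) U₀ (mulCfg U' U₀)) →
      (∀ j, j ≤ i.k → ∀ (z : Site θ.D) (μ : Fin θ.D),
        ((∀ x, InBox (tlo θ.L z j) (thi θ.L z j) x → x ∈ i.Ω j) ∨ (∀ x, InBox (tlo θ.L (z + e μ) j) (thi θ.L (z + e μ) j) x → x ∈ i.Ω j)) →
        ‖(avgIter θ.L (mulCfg U' U₀) j z μ : θ.𝔸) - (avgIter θ.L U₀ j z μ : θ.𝔸)‖ ≤ α₁) →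
      (∀ b ∈ {b : Site θ.D × Fin θ.D | SideTouches (i.Ω 0) b.1 b.2}, ‖((U' b.1 b.2 : θ.𝔸ˣ) : θ.𝔸) - 1‖ ≤ α₁) →
      (∀ m, 1 ≤ m → m ≤ i.k → ∀ (u : Site θ.D → θ.𝔸ˣ) (W : Site θ.D → Fin θ.D → θ.𝔸ˣ) (A' : Site θ.D → Fin θ.D → θ.𝔸),
        (∀ x, u x ∈ unitaryUnits θ.𝔸) → mgauge U₀ u W = U' → Restr129 θ.L m (i.Λs m) U₀ u → LanF146 θ.L i.k i.η (i.Ω 0) i.Λs U₀ φ m W →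
        (∀ y τ, IsSelfAdjoint (A' y τ)) →
        (∀ j, j ≤ m → ∀ y τ, SideTouches (i.Ω j) y τ →
        W y τ = cfgExp i.η A' y τ ∧ ‖A' y τ‖ ≤ r * (α₀ + α₁) * ((θ.L : ℝ) ^ j * i.η)⁻¹) →
        (∀ y τ, (∀ j, j ≤ m → ¬ SideTouches (i.Ω j) y τ) → A' y τ = 0) →
        msup θ.L m i.η (-(1 : ℝ)) (fun j (b : Site θ.D × Fin θ.D) => SideTouches (i.Ω j) b.1 b.2) (fun b => A' b.1 b.2)
        ≤ B₀ * (bondNorm θ.L m i.η (-(3 : ℝ)) i.Ω (fun x μ => Jcur i.η U₀ A' μ x)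
        + wsup 1 (fun p : {p : ℕ × (Site θ.D × Fin θ.D) // p.1 ≤ m ∧ p.2 ∈ towerBondsP θ.L i.Ω (i.Λs m) p.1} =>
        linCovIter θ.L U₀ (iEta i.η A') p.1.1 p.1.2.1 p.1.2.2)) + γ' * B₀ * (α₀ + α₁) ∧
        msup θ.L m i.η (-(2 : ℝ)) (fun j (t : Fin θ.D × Fin θ.D × Site θ.D) => SideTouches (i.Ω j) t.2.2 t.2.1)
        (fun t => covDerivFwd i.η U₀ t.1 (fun z => A' z t.2.1) t.2.2)
        ≤ B₀ * (bondNorm θ.L m i.η (-(3 : ℝ)) i.Ω (fun x μ => Jcur i.η U₀ A' μ x)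
        + wsup 1 (fun p : {p : ℕ × (Site θ.D × Fin θ.D) // p.1 ≤ m ∧ p.2 ∈ towerBondsP θ.L i.Ω (i.Λs m) p.1} =>
        linCovIter θ.L U₀ (iEta i.η A') p.1.1 p.1.2.1 p.1.2.2)) + γ' * B₀ * (α₀ + α₁)))
    -- THE SOURCED b9 SOCKET OF PROPOSITION 3's FRAME at the `Ω₀ = ℤᵈ` law members, threshold `cP3`, `|B₁|` over print's class at the top truncation — HYPOTHESIS
    -- ([Balaban1985BackgroundPropagators] Thm 3.3 with source; = `B8Prop3SrcZd3HPGamma`'s input letter for letter)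
    (SB9srcHP : ∀ i : ZdIdx θ.D θ.L, i.Ω 0 = Set.univ → IdxB8LawsB θ.L i → B8ConstraintBonds.DomainSeq θ.L i.Ω → (∀ l, l < i.k → ∀ z ∈ i.Λs i.k l, ((θ.L : ℤ) ^ l) • z ∈ B8ConstraintBonds.Lam θ.L i.Ω l) → ∀ α₀ α₁ α₂ : ℝ, 0 < α₀ → α₀ ≤ cP3 → 0 < α₁ → 0 < α₂ → α₂ ≤ cP3 →
      ∀ (U₀ W : Site θ.D → Fin θ.D → θ.𝔸ˣ), (∀ x κ, U₀ x κ ∈ unitaryUnits θ.𝔸) → (∀ x κ, W x κ ∈ unitaryUnits θ.𝔸) →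
      ∀ f : Site θ.D → θ.𝔸, InR138 θ.L i.k i.η (i.Ω 0) (i.Λs i.k) U₀ f →
      (∀ x, IsSelfAdjoint (f x)) → (∀ x, x ∉ i.Ω 0 → f x = 0) →
      Bdd θ.L i.k i.η (-(2 : ℝ)) (fun j (x : Site θ.D) => x ∈ i.Ω j) f →
      msup θ.L i.k i.η (-(2 : ℝ)) (fun j (x : Site θ.D) => x ∈ i.Ω j) f < γ₈ * (α₀ + α₁) →
      msup θ.L i.k i.η (-(3 : ℝ)) (fun j (p : Fin θ.D × Site θ.D) => p.2 ∈ i.Ω j) (fun p => covDerivFwd i.η U₀ p.1 f p.2) < γ₈ * (α₀ + α₁) →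
      InAk θ.L i.k i.η α₀ i.Ω U₀ → InAk θ.L i.k i.η α₀ i.Ω (mulCfg W U₀) → IsLandau146W θ.L i.k i.η (i.Ω 0) (i.Λs i.k) U₀ f W →
      ∀ A' : Site θ.D → Fin θ.D → θ.𝔸, (∀ y τ, IsSelfAdjoint (A' y τ)) →
      (∀ j, j ≤ i.k → ∀ (y : Site θ.D) (τ : Fin θ.D), SideTouches (i.Ω j) y τ →
        W y τ = cfgExp i.η A' y τ ∧ ‖A' y τ‖ ≤ α₂ * ((θ.L : ℝ) ^ j * i.η)⁻¹) →
      (∀ (y : Site θ.D) (τ : Fin θ.D), (∀ j, j ≤ i.k → ¬ SideTouches (i.Ω j) y τ) → A' y τ = 0) →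
      msup θ.L i.k i.η (-(1 : ℝ)) (fun j (b : Site θ.D × Fin θ.D) => SideTouches (i.Ω j) b.1 b.2) (fun b => A' b.1 b.2)
          ≤ B₀ * (bondNorm θ.L i.k i.η (-(3 : ℝ)) i.Ω (fun x μ => Jcur i.η U₀ A' μ x)
            + wsup 1 (fun p : {p : ℕ × (Site θ.D × Fin θ.D) // p.1 ≤ i.k ∧ p.2 ∈ towerBondsP θ.L i.Ω (i.Λs i.k) p.1} =>
                linCovIter θ.L U₀ (iEta i.η A') p.1.1 p.1.2.1 p.1.2.2)) + γ'' * B₀ * (α₀ + α₁) ∧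
        msup θ.L i.k i.η (-(2 : ℝ)) (fun j (t : Fin θ.D × Fin θ.D × Site θ.D) => SideTouches (i.Ω j) t.2.2 t.2.1)
            (fun t => covDerivFwd i.η U₀ t.1 (fun z => A' z t.2.1) t.2.2)
          ≤ B₀ * (bondNorm θ.L i.k i.η (-(3 : ℝ)) i.Ω (fun x μ => Jcur i.η U₀ A' μ x)
            + wsup 1 (fun p : {p : ℕ × (Site θ.D × Fin θ.D) // p.1 ≤ i.k ∧ p.2 ∈ towerBondsP θ.L i.Ω (i.Λs i.k) p.1} =>
                linCovIter θ.L U₀ (iEta i.η A') p.1.1 p.1.2.1 p.1.2.2)) + γ'' * B₀ * (α₀ + α₁) ∧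
        bondNorm θ.L i.k i.η (-(3 : ℝ)) i.Ω (fun x μ => pdiv i.η U₀ (plaqCovDeriv i.η U₀ A') μ x)
          ≤ B₀ * (bondNorm θ.L i.k i.η (-(3 : ℝ)) i.Ω (fun x μ => Jcur i.η U₀ A' μ x)
            + wsup 1 (fun p : {p : ℕ × (Site θ.D × Fin θ.D) // p.1 ≤ i.k ∧ p.2 ∈ towerBondsP θ.L i.Ω (i.Λs i.k) p.1} =>
                linCovIter θ.L U₀ (iEta i.η A') p.1.1 p.1.2.1 p.1.2.2)) + γ'' * B₀ * (α₀ + α₁) ∧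
        bondNorm θ.L i.k i.η (-(3 : ℝ)) i.Ω (fun x μ => covLap i.η U₀ (fun z => A' z μ) x)
          ≤ B₀ * (bondNorm θ.L i.k i.η (-(3 : ℝ)) i.Ω (fun x μ => Jcur i.η U₀ A' μ x)
            + wsup 1 (fun p : {p : ℕ × (Site θ.D × Fin θ.D) // p.1 ≤ i.k ∧ p.2 ∈ towerBondsP θ.L i.Ω (i.Λs i.k) p.1} =>
                linCovIter θ.L U₀ (iEta i.η A') p.1.1 p.1.2.1 p.1.2.2)) + γ'' * B₀ * (α₀ + α₁) ∧
        msup θ.L i.k i.η (-(2 + β)) (fun j (q : Fin θ.D × Fin θ.D × (Site θ.D × Site θ.D)) => q.2.2 ∈ AdmPair i.η len ∧ q.2.2.1 ∈ i.Ω j ∧ q.2.2.2 ∈ i.Ω j)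
            (fun q => hquot i.η β len U₀ (covDerivFwd i.η U₀ q.1 (fun z => A' z q.2.1)) q.2.2)
          ≤ B₀β * (bondNorm θ.L i.k i.η (-(3 : ℝ)) i.Ω (fun x μ => Jcur i.η U₀ A' μ x)
            + wsup 1 (fun p : {p : ℕ × (Site θ.D × Fin θ.D) // p.1 ≤ i.k ∧ p.2 ∈ towerBondsP θ.L i.Ω (i.Λs i.k) p.1} =>
                linCovIter θ.L U₀ (iEta i.η A') p.1.1 p.1.2.1 p.1.2.2)) + γβ * (α₀ + α₁))
    (M₁ R : ℕ) (hM₁ : 1 ≤ M₁) :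
    ∃ (lam8 : ResidB8 θ) (P : ℕ) (c₁ : ℝ) (ρ₀ : ℕ)
      (ax : ∀ j : IdxB8SubDPer θ P, (famB8OfRecordPer θ (lam8.cutSubBP₅ c₁ ρ₀).β (lam8.cutSubBP₅ c₁ ρ₀).len P j).Cfg →
        (famB8OfRecordPer θ (lam8.cutSubBP₅ c₁ ρ₀).β (lam8.cutSubBP₅ c₁ ρ₀).len P j).Pert → (famB8OfRecordPer θ (lam8.cutSubBP₅ c₁ ρ₀).β (lam8.cutSubBP₅ c₁ ρ₀).len P j).Pert),
      (0 < P ∧ M₁ * θ.L ∣ P) ∧ 0 < c₁ ∧ 1 ≤ ρ₀ ∧ B8LeafOfRecordSubBP₂DPerκ θ P M₁ R ⟨lam8.cutSubBP₅ c₁ ρ₀, ax⟩ := by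
  obtain ⟨lam, c₁, ρ₀, ax, hc₁, hρ₀, h⟩ := exists_residB8_b8LeafOfRecordSubBP₂DPerκ_cutSubBP₅_of_lettersSrc_γ'_guarded θ hD hL5 hcB9 hB₀'H hB₂' hBG hBR hcL
    SLet SLetUB SB9P hcP3 hγ₈ hγ' hγ'' hB hB₀β SH59src SB9srcHP (M₁ * θ.L) M₁ R
  have hL1 : 1 ≤ θ.L := le_trans one_le_two θ.two_le_L
  exact ⟨lam, M₁ * θ.L, c₁, ρ₀, ax, ⟨Nat.mul_pos (Nat.lt_of_lt_of_le Nat.zero_lt_one hM₁) (Nat.lt_of_lt_of_le Nat.zero_lt_one hL1), dvd_rfl⟩, hc₁, hρ₀, h⟩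

end Summit.QuantumFields.YangMills.BalabanUVNodes.N05SubBP2DPerKappaSlotExistsGuarded

end
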